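import Summits.AtomisticToContinuum.Crystallization.Theorems.LoopTunnelDialForcePricingFrame

/-!
# LoopTunnelDial — FORCE PRICING kit 15 «FRAME», part B: checker ROWS for rational boxes; the censored GRID certificate

Companion of `LoopTunnelDialForcePricingFrame` (critic row 367 (4)(d)).  In the frame `x = 0`, `q = a·e₃` a cell is a coordinate box `[lo, hi] ⊂ ℝ³`
and every check of `CellCert.BoxValid` reduces to the closed-form real-valued ROWS proved in §9 (replay = `norm_num` on rationals per row; no
interval library, no irrational breakpoints): norms `sLo ≤ |z|² ≤ sHi`; EXCLUSION rows (inner `sHi < 49/100`, outer `R² < sLo`, partner ball = the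
shifted inner row, required at BOTH ends of the a-box); the C3 MESH rows; the C2 INTERVAL ROW `frameWeight c a z ≤ rowBound c a lo hi` in the variable
`s = |z|²`: `−V = φ(s) = s⁻³/6 − s⁻⁶/12` (↑ on `s ≤ 1`, ↓ on `s ≥ 1`, `≤ 1/12`) and push `−c·a·h(s)·z₂`, `h(s) = s⁻⁷ − s⁻⁴ = w⁴(w³ − 1)` (`w = 1/s`),
`h ≤ H⁺ = s_lo⁻⁴(s_lo⁻³ − 1)₊`, `−h ≤ H⁻ = (max s_lo 1)⁻⁴(1 − s_hi⁻³)₊` — monotonicity of the two factors, split at `s = 1` only (in tree units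
`V′(1) = 0 = g(1)`; the critical point `s³ = 7/4` of `h` is never used); `rowBound` is monotone in `a`, so ONE evaluation at `a₂` serves the a-box.
§10: the CENSORED GRID CERTIFICATE `gridCert row g n drop` (live cells = grid boxes not dropped, each dropped box fires an exclusion row;
`wt := row` for any row that SERVES the a-box (`RowServes`: majorises the frame weight at both ends) — here `rowBound c a₂`, in part C the
sharp joint row — so C2 costs nothing at replay; singleton cliques, `y {i} = (wt i)₊`) is PROVED box-valid for any grid covering `[−R, R]³` with
mesh row `< 49/100`.  CAVEAT of record (quantified in part C): `rowBound` bounds `−V` and the push SEPARATELY, each at its own worst radius; near the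
hard core both are steep with opposite slopes (their sum is flat at the working price), so `rowBound` over-estimates by ≈ 50·Δs per point there
(cell side 0.02 at r ≈ 0.75 behind the centre: true cell sup 0.017, `rowBound` 0.59) — use part C's `rowSharp2` for cells inside the unit sphere.
TAG 129′(δ) schema per a-box: grid `g, n`; drop-list with the firing row; cliques; `y` — `wt` is NOT emitted (Lean recomputes the row).  0 sorry.
-/

noncomputable section

namespace Summit.AtomisticToContinuum.Crystallization.Theorems.LoopTunnelDialForcePricing

open scoped BigOperators Classical InnerProductSpace
open Literature.MathematicalPhysics.StatisticalMechanics
open Summit.AtomisticToContinuum.Crystallization.Theorems.GrainPercolationDialCrossCeiling (E3)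
open Summit.AtomisticToContinuum.Crystallization.Theorems.ChargedEnergyGapNegative (eStar)
open Summit.AtomisticToContinuum.Crystallization.Theorems.LoopTunnelDialContactLaw
open Summit.AtomisticToContinuum.Crystallization.Theorems.LoopTunnelDialRangeTails

/-! ### §9 Checker ROWS for coordinate boxes in the frame (PROVED) -/

/-- The closed coordinate box `[lo, hi] ⊂ ℝ³`. [line vocabulary · LoopTunnelDial contact dial · crux stmt-AtomisticToContinuum-27294 · definition, not a cited fact] -/
def box (lo hi : Fin 3 → ℝ) : Set E3 := {z | ∀ k, lo k ≤ z k ∧ z k ≤ hi k}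

/-- `‖z‖² = z₀² + z₁² + z₂²` in `ℝ³` (private: the same one-liner is `Literature.Geometry.Lorentzian.E3.norm_sq` in an unrelated module). -/
private theorem norm_sq_eq_sum3 (z : E3) : ‖z‖ ^ 2 = z 0 ^ 2 + z 1 ^ 2 + z 2 ^ 2 := by
  rw [EuclideanSpace.real_norm_sq_eq, Fin.sum_univ_three]

/-- Each coordinate is bounded by the norm (private: same one-liner exists in an unrelated Literature module). -/
private theorem abs_apply_le_norm (z : E3) (k : Fin 3) : |z k| ≤ ‖z‖ := by
  simpa [Real.norm_eq_abs] using PiLp.norm_apply_le z k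

/-- `sHi lo hi = Σ_k max(lo_k², hi_k²)` — an upper bound of `|z|²` on the box. [line vocabulary · LoopTunnelDial contact dial · crux stmt-AtomisticToContinuum-27294 · definition, not a cited fact] -/
def sHi (lo hi : Fin 3 → ℝ) : ℝ :=
  max (lo 0 ^ 2) (hi 0 ^ 2) + max (lo 1 ^ 2) (hi 1 ^ 2) + max (lo 2 ^ 2) (hi 2 ^ 2)

/-- `sLo lo hi = Σ_k (max(lo_k, −hi_k, 0))²` — a lower bound of `|z|²` on the box. [line vocabulary · LoopTunnelDial contact dial · crux stmt-AtomisticToContinuum-27294 · definition, not a cited fact] -/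
def sLo (lo hi : Fin 3 → ℝ) : ℝ :=
  max (max (lo 0) (-hi 0)) 0 ^ 2 + max (max (lo 1) (-hi 1)) 0 ^ 2 + max (max (lo 2) (-hi 2)) 0 ^ 2

/-- `t² ≤ max l² h²` for `t ∈ [l, h]`. -/
theorem sq_le_max_sq {l h t : ℝ} (hl : l ≤ t) (hh : t ≤ h) : t ^ 2 ≤ max (l ^ 2) (h ^ 2) := by
  rcases le_or_gt 0 t with ht | ht
  · exact le_max_of_le_right (pow_le_pow_left₀ ht hh 2)
  · exact le_max_of_le_left (by nlinarith)

/-- `(max (max l (-h)) 0)² ≤ t²` for `t ∈ [l, h]` (lower bound of `t²` on a box edge). -/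
theorem max_sq_le_sq {l h t : ℝ} (hl : l ≤ t) (hh : t ≤ h) : max (max l (-h)) 0 ^ 2 ≤ t ^ 2 := by
  have hm0 : 0 ≤ max (max l (-h)) 0 := le_max_right _ _
  have hmt : max (max l (-h)) 0 ≤ |t| :=
    max_le (max_le (hl.trans (le_abs_self t)) (by linarith [neg_abs_le t])) (abs_nonneg t)
  calc max (max l (-h)) 0 ^ 2 ≤ |t| ^ 2 := pow_le_pow_left₀ hm0 hmt 2
    _ = t ^ 2 := sq_abs t

/-- ROW N⁺: `|z|² ≤ sHi` on the box. -/
theorem norm_sq_le_sHi {lo hi : Fin 3 → ℝ} {z : E3} (hz : z ∈ box lo hi) : ‖z‖ ^ 2 ≤ sHi lo hi := by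
  rw [norm_sq_eq_sum3]; unfold sHi
  have h0 := sq_le_max_sq (hz 0).1 (hz 0).2
  have h1 := sq_le_max_sq (hz 1).1 (hz 1).2
  have h2 := sq_le_max_sq (hz 2).1 (hz 2).2
  linarith

/-- ROW N⁻: `sLo ≤ |z|²` on the box. -/
theorem sLo_le_norm_sq {lo hi : Fin 3 → ℝ} {z : E3} (hz : z ∈ box lo hi) : sLo lo hi ≤ ‖z‖ ^ 2 := by
  rw [norm_sq_eq_sum3]; unfold sLo
  have h0 := max_sq_le_sq (hz 0).1 (hz 0).2
  have h1 := max_sq_le_sq (hz 1).1 (hz 1).2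
  have h2 := max_sq_le_sq (hz 2).1 (hz 2).2
  linarith

/-- ROW X-in (inner exclusion): `sHi < 49/100` ⇒ no point of the box has `7/10 ≤ |z|`. -/
theorem not_le_norm_of_sHi_lt {lo hi : Fin 3 → ℝ} {z : E3} (hz : z ∈ box lo hi) (h : sHi lo hi < 49 / 100) :
    ¬ (7 : ℝ) / 10 ≤ ‖z‖ := by
  intro h7
  have := norm_sq_le_sHi hz
  nlinarith

/-- ROW X-out (outer exclusion): `R² < sLo` ⇒ no point of the box has `|z| ≤ R` (`R ≥ 0`). -/
theorem not_norm_le_of_lt_sLo {lo hi : Fin 3 → ℝ} {z : E3} {R : ℝ} (hz : z ∈ box lo hi) (hR : 0 ≤ R)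
    (h : R ^ 2 < sLo lo hi) : ¬ ‖z‖ ≤ R := by
  intro hzR
  have := sLo_le_norm_sq hz
  nlinarith [norm_nonneg z]

/-- The partner distance in coordinates: `|a·e₃ − z|² = z₀² + z₁² + (z₂ − a)²`. -/
theorem dist_smul_e₃_sq (a : ℝ) (z : E3) : dist (a • e₃) z ^ 2 = z 0 ^ 2 + z 1 ^ 2 + (z 2 - a) ^ 2 := by
  have h0 : (a • e₃ - z) 0 = -z 0 := by simp
  have h1 : (a • e₃ - z) 1 = -z 1 := by simp
  have h2 : (a • e₃ - z) 2 = a - z 2 := by simp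
  rw [dist_eq_norm, norm_sq_eq_sum3, h0, h1, h2]
  ring

/-- ROW X-q (partner-ball exclusion at one end `a`): the shifted `sHi < 49/100` ⇒ `|a·e₃ − z| < 7/10` on the box. -/
theorem dist_smul_e₃_lt_of_row {lo hi : Fin 3 → ℝ} {z : E3} (hz : z ∈ box lo hi) (a : ℝ)
    (h : max (lo 0 ^ 2) (hi 0 ^ 2) + max (lo 1 ^ 2) (hi 1 ^ 2) + max ((lo 2 - a) ^ 2) ((hi 2 - a) ^ 2) < 49 / 100) :
    dist (a • e₃) z < 7 / 10 := by
  have h0 := sq_le_max_sq (hz 0).1 (hz 0).2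
  have h1 := sq_le_max_sq (hz 1).1 (hz 1).2
  have h2 : (z 2 - a) ^ 2 ≤ max ((lo 2 - a) ^ 2) ((hi 2 - a) ^ 2) :=
    sq_le_max_sq (by linarith [(hz 2).1]) (by linarith [(hz 2).2])
  have hd := dist_smul_e₃_sq a z
  have hsq : dist (a • e₃) z ^ 2 < (7 / 10) ^ 2 := by nlinarith
  exact (pow_lt_pow_iff_left₀ dist_nonneg (by norm_num) two_ne_zero).1 hsq

/-- ROW C3 (mesh): two points of ONE box with `Σ_k (hi_k − lo_k)² < 49/100` are `< 7/10` apart. -/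
theorem dist_lt_of_same_box {lo hi : Fin 3 → ℝ} {z z' : E3} (hz : z ∈ box lo hi) (hz' : z' ∈ box lo hi)
    (h : (hi 0 - lo 0) ^ 2 + (hi 1 - lo 1) ^ 2 + (hi 2 - lo 2) ^ 2 < 49 / 100) : dist z z' < 7 / 10 := by
  have hk : ∀ k, (z k - z' k) ^ 2 ≤ (hi k - lo k) ^ 2 := fun k =>
    sq_le_sq' (by linarith [(hz k).1, (hz' k).2]) (by linarith [(hz k).2, (hz' k).1])
  have hsq : dist z z' ^ 2 < (7 / 10) ^ 2 := by
    rw [dist_eq_norm, norm_sq_eq_sum3]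
    simp only [PiLp.sub_apply]
    nlinarith [hk 0, hk 1, hk 2]
  exact (pow_lt_pow_iff_left₀ dist_nonneg (by norm_num) two_ne_zero).1 hsq

/-- ROW C3 (two boxes): `Σ_k max((lo_k − hi′_k)², (hi_k − lo′_k)²) < 49/100` ⇒ any point of the first box is `< 7/10` from any point of the second. -/
theorem dist_lt_of_boxes {lo hi lo' hi' : Fin 3 → ℝ} {z z' : E3} (hz : z ∈ box lo hi) (hz' : z' ∈ box lo' hi')
    (h : max ((lo 0 - hi' 0) ^ 2) ((hi 0 - lo' 0) ^ 2) + max ((lo 1 - hi' 1) ^ 2) ((hi 1 - lo' 1) ^ 2) +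
      max ((lo 2 - hi' 2) ^ 2) ((hi 2 - lo' 2) ^ 2) < 49 / 100) : dist z z' < 7 / 10 := by
  have hk : ∀ k, (z k - z' k) ^ 2 ≤ max ((lo k - hi' k) ^ 2) ((hi k - lo' k) ^ 2) := fun k =>
    sq_le_max_sq (by linarith [(hz k).1, (hz' k).2]) (by linarith [(hz k).2, (hz' k).1])
  have hsq : dist z z' ^ 2 < (7 / 10) ^ 2 := by
    rw [dist_eq_norm, norm_sq_eq_sum3]
    simp only [PiLp.sub_apply]
    nlinarith [hk 0, hk 1, hk 2]
  exact (pow_lt_pow_iff_left₀ dist_nonneg (by norm_num) two_ne_zero).1 hsq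

/-- `φ(s) = s⁻³/6 − s⁻⁶/12 = −V(√s)`. [line vocabulary · LoopTunnelDial contact dial · crux stmt-AtomisticToContinuum-27294 · definition, not a cited fact] -/
def phi (s : ℝ) : ℝ := s⁻¹ ^ 3 / 6 - s⁻¹ ^ 6 / 12

/-- `h(s) = s⁻⁷ − s⁻⁴ = g(√s)/√s`. [line vocabulary · LoopTunnelDial contact dial · crux stmt-AtomisticToContinuum-27294 · definition, not a cited fact] -/
def hfun (s : ℝ) : ℝ := s⁻¹ ^ 7 - s⁻¹ ^ 4

/-- The frame weight in the variable `s = |z|²`: `frameWeight c a z = φ(s) − c·a·h(s)·z₂`. -/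
theorem frameWeight_eq (c a : ℝ) (z : E3) :
    frameWeight c a z = phi (‖z‖ ^ 2) - c * a * (hfun (‖z‖ ^ 2) * z 2) := by
  unfold frameWeight lennardJones phi hfun; ring

/-- `phi s ≤ 1/12` for every `s`. -/
theorem phi_le_twelfth (s : ℝ) : phi s ≤ 1 / 12 := by
  unfold phi
  nlinarith [sq_nonneg (s⁻¹ ^ 3 - 1)]

/-- `φ` is increasing on `(0, 1]`. -/
theorem phi_mono_of_le_one {s s' : ℝ} (hs : 0 < s) (hss' : s ≤ s') (hs'1 : s' ≤ 1) : phi s ≤ phi s' := by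
  have hs' : 0 < s' := lt_of_lt_of_le hs hss'
  have hu' : 1 ≤ s'⁻¹ ^ 3 := one_le_pow₀ ((one_le_inv₀ hs').2 hs'1)
  have hu : s'⁻¹ ^ 3 ≤ s⁻¹ ^ 3 := pow_le_pow_left₀ (inv_nonneg.2 hs'.le) (inv_anti₀ hs hss') 3
  unfold phi
  nlinarith [mul_nonneg (sub_nonneg.2 hu) (by linarith : (0 : ℝ) ≤ s⁻¹ ^ 3 + s'⁻¹ ^ 3 - 2)]

/-- `φ` is decreasing on `[1, ∞)`. -/
theorem phi_anti_of_one_le {s s' : ℝ} (hs' : 1 ≤ s') (hss' : s' ≤ s) : phi s ≤ phi s' := by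
  have hs'0 : 0 < s' := by linarith
  have hu' : s'⁻¹ ^ 3 ≤ 1 := pow_le_one₀ (inv_nonneg.2 hs'0.le) (inv_le_one_of_one_le₀ hs')
  have hu : s⁻¹ ^ 3 ≤ s'⁻¹ ^ 3 := pow_le_pow_left₀ (inv_nonneg.2 (by linarith)) (inv_anti₀ hs'0 hss') 3
  unfold phi
  nlinarith [mul_nonneg (sub_nonneg.2 hu) (by linarith : (0 : ℝ) ≤ 2 - s⁻¹ ^ 3 - s'⁻¹ ^ 3)]

/-- `H⁺(s_lo) = s_lo⁻⁴ · (s_lo⁻³ − 1)₊` — a bound of `h` on `[s_lo, ∞)`. [line vocabulary · LoopTunnelDial contact dial · crux stmt-AtomisticToContinuum-27294 · definition, not a cited fact] -/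
def hPlus (sl : ℝ) : ℝ := sl⁻¹ ^ 4 * max (sl⁻¹ ^ 3 - 1) 0

/-- `H⁻(s_lo, s_hi) = (max s_lo 1)⁻⁴ · (1 − s_hi⁻³)₊` — a bound of `−h` on `[s_lo, s_hi]`. [line vocabulary · LoopTunnelDial contact dial · crux stmt-AtomisticToContinuum-27294 · definition, not a cited fact] -/
def hMinus (sl su : ℝ) : ℝ := (max sl 1)⁻¹ ^ 4 * max (1 - su⁻¹ ^ 3) 0

/-- `hPlus sl ≥ 0` for `sl > 0`. -/
theorem hPlus_nonneg {sl : ℝ} (hsl : 0 < sl) : 0 ≤ hPlus sl :=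
  mul_nonneg (pow_nonneg (inv_nonneg.2 hsl.le) 4) (le_max_right _ _)

/-- `hMinus sl su ≥ 0`. -/
theorem hMinus_nonneg (sl su : ℝ) : 0 ≤ hMinus sl su :=
  mul_nonneg (pow_nonneg (inv_nonneg.2 (lt_max_of_lt_right one_pos).le) 4) (le_max_right _ _)

/-- Upper envelope: `hfun s ≤ hPlus sl` for `0 < sl ≤ s`. -/
theorem hfun_le_hPlus {sl s : ℝ} (hsl : 0 < sl) (h : sl ≤ s) : hfun s ≤ hPlus sl := by
  have hs : 0 < s := lt_of_lt_of_le hsl h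
  have hw : s⁻¹ ≤ sl⁻¹ := inv_anti₀ hsl h
  have hw0 : 0 ≤ s⁻¹ := inv_nonneg.2 hs.le
  have hsl0 : 0 ≤ sl⁻¹ ^ 4 := pow_nonneg (inv_nonneg.2 hsl.le) 4
  have heq : hfun s = s⁻¹ ^ 4 * (s⁻¹ ^ 3 - 1) := by unfold hfun; ring
  rw [heq]; unfold hPlus
  rcases le_or_gt (s⁻¹ ^ 3 - 1) 0 with hneg | hpos
  · calc s⁻¹ ^ 4 * (s⁻¹ ^ 3 - 1) ≤ 0 := by nlinarith [pow_nonneg hw0 4]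
      _ ≤ sl⁻¹ ^ 4 * max (sl⁻¹ ^ 3 - 1) 0 := mul_nonneg hsl0 (le_max_right _ _)
  · calc s⁻¹ ^ 4 * (s⁻¹ ^ 3 - 1) ≤ sl⁻¹ ^ 4 * (sl⁻¹ ^ 3 - 1) :=
          mul_le_mul (pow_le_pow_left₀ hw0 hw 4) (by linarith [pow_le_pow_left₀ hw0 hw 3]) hpos.le hsl0
      _ ≤ sl⁻¹ ^ 4 * max (sl⁻¹ ^ 3 - 1) 0 := mul_le_mul_of_nonneg_left (le_max_left _ _) hsl0

/-- Lower envelope: `-hfun s ≤ hMinus sl su` for `0 < sl ≤ s ≤ su`. -/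
theorem neg_hfun_le_hMinus {sl su s : ℝ} (hsl : 0 < sl) (h1 : sl ≤ s) (h2 : s ≤ su) : -hfun s ≤ hMinus sl su := by
  have hs : 0 < s := lt_of_lt_of_le hsl h1
  have hsu : 0 < su := lt_of_lt_of_le hs h2
  have hw0 : 0 ≤ s⁻¹ := inv_nonneg.2 hs.le
  have hm1 : 0 < max sl 1 := lt_max_of_lt_right one_pos
  have hM0 : 0 ≤ (max sl 1)⁻¹ ^ 4 := pow_nonneg (inv_nonneg.2 hm1.le) 4
  have heq : -hfun s = s⁻¹ ^ 4 * (1 - s⁻¹ ^ 3) := by unfold hfun; ring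
  rw [heq]; unfold hMinus
  rcases le_or_gt (1 - s⁻¹ ^ 3) 0 with hneg | hpos
  · calc s⁻¹ ^ 4 * (1 - s⁻¹ ^ 3) ≤ 0 := by nlinarith [pow_nonneg hw0 4]
      _ ≤ (max sl 1)⁻¹ ^ 4 * max (1 - su⁻¹ ^ 3) 0 := mul_nonneg hM0 (le_max_right _ _)
  · have hs1 : 1 ≤ s := by
      by_contra hlt
      have h1' : 1 ≤ s⁻¹ := (one_le_inv₀ hs).2 (not_le.1 hlt).le
      have : (1 : ℝ) ≤ s⁻¹ ^ 3 := one_le_pow₀ h1'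
      linarith
    have hw : s⁻¹ ≤ (max sl 1)⁻¹ := inv_anti₀ hm1 (max_le h1 hs1)
    have hwu : su⁻¹ ≤ s⁻¹ := inv_anti₀ hs h2
    calc s⁻¹ ^ 4 * (1 - s⁻¹ ^ 3) ≤ (max sl 1)⁻¹ ^ 4 * (1 - su⁻¹ ^ 3) :=
          mul_le_mul (pow_le_pow_left₀ hw0 hw 4) (by linarith [pow_le_pow_left₀ (inv_nonneg.2 hsu.le) hwu 3]) hpos.le hM0
      _ ≤ (max sl 1)⁻¹ ^ 4 * max (1 - su⁻¹ ^ 3) 0 := mul_le_mul_of_nonneg_left (le_max_left _ _) hM0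

/-- `nvBound s_lo s_hi` — the bound of `φ = −V` on `[s_lo, s_hi]`: `φ(s_hi)` if `s_hi ≤ 1`, `φ(s_lo)` if `s_lo ≥ 1`, else `1/12`. [line vocabulary · LoopTunnelDial contact dial · crux stmt-AtomisticToContinuum-27294 · definition, not a cited fact] -/
def nvBound (sl su : ℝ) : ℝ := if su ≤ 1 then phi su else if 1 ≤ sl then phi sl else 1 / 12

/-- `phi s ≤ nvBound sl su` on `[sl, su]` (`sl > 0`). -/
theorem phi_le_nvBound {sl su s : ℝ} (hsl : 0 < sl) (h1 : sl ≤ s) (h2 : s ≤ su) : phi s ≤ nvBound sl su := by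
  unfold nvBound
  split_ifs with hsu hsl1
  · exact phi_mono_of_le_one (lt_of_lt_of_le hsl h1) h2 hsu
  · exact phi_anti_of_one_le hsl1 h1
  · exact phi_le_twelfth s

/-- The push part of the row: `−h(s)·t ≤ H⁺·(−lo₂)₊ + H⁻·(hi₂)₊` for `s ∈ [s_lo, s_hi]`, `t ∈ [lo₂, hi₂]`. -/
theorem push_le_row {sl su s t lo₂ hi₂ : ℝ} (hsl : 0 < sl) (h1 : sl ≤ s) (h2 : s ≤ su) (hlo : lo₂ ≤ t) (hhi : t ≤ hi₂) :
    -(hfun s * t) ≤ hPlus sl * max (-lo₂) 0 + hMinus sl su * max hi₂ 0 := by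
  have hP := hfun_le_hPlus hsl h1
  have hM := neg_hfun_le_hMinus hsl h1 h2
  have hP0 := hPlus_nonneg hsl
  have hM0 := hMinus_nonneg sl su
  have ha : -t ≤ max (-lo₂) 0 := by linarith [le_max_left (-lo₂) 0]
  have hb : t ≤ max hi₂ 0 := hhi.trans (le_max_left _ _)
  have hm1 : 0 ≤ max (-lo₂) 0 := le_max_right _ _
  have hm2 : 0 ≤ max hi₂ 0 := le_max_right _ _
  rcases le_or_gt 0 (hfun s) with hf | hf
  · nlinarith [mul_le_mul_of_nonneg_left ha hf, mul_le_mul_of_nonneg_right hP hm1, mul_nonneg hM0 hm2]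
  · nlinarith [mul_le_mul_of_nonneg_left hb (neg_nonneg.2 hf.le), mul_le_mul_of_nonneg_right hM hm2, mul_nonneg hP0 hm1]

/-- **`rowBound c a lo hi` — THE C2 INTERVAL ROW** (closed form in the box corners; `s_lo := max(sLo, 49/100)` uses admissibility `|z| ≥ 7/10`). [line vocabulary · LoopTunnelDial contact dial · crux stmt-AtomisticToContinuum-27294 · definition, not a cited fact] -/
def rowBound (c a : ℝ) (lo hi : Fin 3 → ℝ) : ℝ :=
  nvBound (max (sLo lo hi) (49 / 100)) (sHi lo hi) +
    c * a * (hPlus (max (sLo lo hi) (49 / 100)) * max (-lo 2) 0 +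
      hMinus (max (sLo lo hi) (49 / 100)) (sHi lo hi) * max (hi 2) 0)

/-- **THE C2 ROW IS SOUND (PROVED):** `frameWeight c a z ≤ rowBound c a lo hi` for every `z` of the box with `|z| ≥ 7/10` (`c, a ≥ 0`). -/
theorem frameWeight_le_rowBound {c a : ℝ} (hc : 0 ≤ c) (ha : 0 ≤ a) {lo hi : Fin 3 → ℝ} {z : E3}
    (hz : z ∈ box lo hi) (h7 : (7 : ℝ) / 10 ≤ ‖z‖) : frameWeight c a z ≤ rowBound c a lo hi := by
  have hsl : 0 < max (sLo lo hi) (49 / 100) := lt_max_of_lt_right (by norm_num)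
  have h1 : max (sLo lo hi) (49 / 100) ≤ ‖z‖ ^ 2 := max_le (sLo_le_norm_sq hz) (by nlinarith)
  have h2 : ‖z‖ ^ 2 ≤ sHi lo hi := norm_sq_le_sHi hz
  have hv := phi_le_nvBound hsl h1 h2
  have hp := push_le_row hsl h1 h2 (hz 2).1 (hz 2).2
  rw [frameWeight_eq]; unfold rowBound
  nlinarith [mul_le_mul_of_nonneg_left hp (mul_nonneg hc ha)]

/-- The row bound is monotone in `a` (`c ≥ 0`): one evaluation at the upper end `a₂` serves the whole a-box. -/
theorem rowBound_mono {c a₁ a₂ : ℝ} (hc : 0 ≤ c) (h : a₁ ≤ a₂) (lo hi : Fin 3 → ℝ) :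
    rowBound c a₁ lo hi ≤ rowBound c a₂ lo hi := by
  unfold rowBound
  have hB : 0 ≤ hPlus (max (sLo lo hi) (49 / 100)) * max (-lo 2) 0 +
      hMinus (max (sLo lo hi) (49 / 100)) (sHi lo hi) * max (hi 2) 0 :=
    add_nonneg (mul_nonneg (hPlus_nonneg (lt_max_of_lt_right (by norm_num))) (le_max_right _ _))
      (mul_nonneg (hMinus_nonneg _ _) (le_max_right _ _))
  nlinarith [mul_le_mul_of_nonneg_left h (mul_nonneg hc hB)]

/-! ### §10 (d) The censored GRID CERTIFICATE with singleton cliques over an arbitrary serving row (PROVED; toys in part C) -/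

/-- Multi-index encoding `ℕ³ → ℕ` (Cantor pairing). [line vocabulary · LoopTunnelDial contact dial · crux stmt-AtomisticToContinuum-27294 · definition, not a cited fact] -/
def enc (j : Fin 3 → ℕ) : ℕ := Nat.pair (j 0) (Nat.pair (j 1) (j 2))

/-- Its decoding. [line vocabulary · LoopTunnelDial contact dial · crux stmt-AtomisticToContinuum-27294 · definition, not a cited fact] -/
def decd (i : ℕ) : Fin 3 → ℕ :=
  ![(Nat.unpair i).1, (Nat.unpair (Nat.unpair i).2).1, (Nat.unpair (Nat.unpair i).2).2]

/-- `decd ∘ enc = id` on triples of naturals. -/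
@[simp] theorem decd_enc (j : Fin 3 → ℕ) : decd (enc j) = j := by
  funext k
  fin_cases k <;> simp [decd, enc, Nat.unpair_pair]

/-- Lower corner of the grid box `j` of the grid `g`. [line vocabulary · LoopTunnelDial contact dial · crux stmt-AtomisticToContinuum-27294 · definition, not a cited fact] -/
def gridLo (g : Fin 3 → ℕ → ℝ) (j : Fin 3 → ℕ) : Fin 3 → ℝ := fun k => g k (j k)

/-- Upper corner of the grid box `j` of the grid `g`. [line vocabulary · LoopTunnelDial contact dial · crux stmt-AtomisticToContinuum-27294 · definition, not a cited fact] -/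
def gridHi (g : Fin 3 → ℕ → ℝ) (j : Fin 3 → ℕ) : Fin 3 → ℝ := fun k => g k (j k + 1)

/-- `Excluded R a₁ a₂ lo hi` — one of the exclusion rows fires on the box: inner, outer, or partner-ball at BOTH ends of the a-box. [line vocabulary · LoopTunnelDial contact dial · crux stmt-AtomisticToContinuum-27294 · definition, not a cited fact] -/
def Excluded (R a₁ a₂ : ℝ) (lo hi : Fin 3 → ℝ) : Prop :=
  sHi lo hi < 49 / 100 ∨ R ^ 2 < sLo lo hi ∨
    (max (lo 0 ^ 2) (hi 0 ^ 2) + max (lo 1 ^ 2) (hi 1 ^ 2) + max ((lo 2 - a₁) ^ 2) ((hi 2 - a₁) ^ 2) < 49 / 100 ∧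
      max (lo 0 ^ 2) (hi 0 ^ 2) + max (lo 1 ^ 2) (hi 1 ^ 2) + max ((lo 2 - a₂) ^ 2) ((hi 2 - a₂) ^ 2) < 49 / 100)

/-- An excluded box meets no point that must be covered in `BoxValid`'s C1. -/
theorem false_of_excluded {R a₁ a₂ : ℝ} {lo hi : Fin 3 → ℝ} {z : E3} (hz : z ∈ box lo hi) (hR : 0 ≤ R)
    (hx : Excluded R a₁ a₂ lo hi) (h7 : (7 : ℝ) / 10 ≤ ‖z‖) (hzR : ‖z‖ ≤ R)
    (hor : (7 : ℝ) / 10 ≤ dist (a₁ • e₃) z ∨ (7 : ℝ) / 10 ≤ dist (a₂ • e₃) z) : False := by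
  rcases hx with h | h | ⟨hq₁, hq₂⟩
  · exact not_le_norm_of_sHi_lt hz h h7
  · exact not_norm_le_of_lt_sLo hz hR h hzR
  · rcases hor with h | h
    · exact absurd (dist_smul_e₃_lt_of_row hz a₁ hq₁) (not_lt.2 h)
    · exact absurd (dist_smul_e₃_lt_of_row hz a₂ hq₂) (not_lt.2 h)

/-- A weight ROW serves the a-box `[a₁, a₂]` at price `c`: it majorises the frame weight at both ends on every box point with `|z| ≥ 7/10`.
[line vocabulary · LoopTunnelDial contact dial · crux stmt-AtomisticToContinuum-27294 · definition, not a cited fact] -/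
def RowServes (c a₁ a₂ : ℝ) (row : (Fin 3 → ℝ) → (Fin 3 → ℝ) → ℝ) : Prop :=
  ∀ (lo hi : Fin 3 → ℝ) (z : E3), z ∈ box lo hi → (7 : ℝ) / 10 ≤ ‖z‖ → frameWeight c a₁ z ≤ row lo hi ∧ frameWeight c a₂ z ≤ row lo hi

/-- `rowBound c a₂` serves `[a₁, a₂]` (`0 ≤ c`, `0 ≤ a₁ ≤ a₂`; monotone in `a`). -/
theorem rowServes_rowBound {c a₁ a₂ : ℝ} (hc : 0 ≤ c) (ha₁ : 0 ≤ a₁) (h12 : a₁ ≤ a₂) : RowServes c a₁ a₂ (rowBound c a₂) :=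
  fun _ _ _ hz h7 => ⟨(frameWeight_le_rowBound hc ha₁ hz h7).trans (rowBound_mono hc h12 _ _),
    frameWeight_le_rowBound hc (ha₁.trans h12) hz h7⟩

/-- **THE CENSORED SINGLETON-CLIQUE GRID CERTIFICATE** with weight row `row` (kit 15: `rowBound c a₂`, or the sharp `rowSharp2 c a₁ a₂` of
part C): live cells = the grid boxes `j` (`j k < n k`) not dropped, `wt := row`, cliques = singletons, `y {i} = (wt i)₊`. [line vocabulary · LoopTunnelDial contact dial · crux stmt-AtomisticToContinuum-27294 · definition, not a cited fact] -/
def gridCert (row : (Fin 3 → ℝ) → (Fin 3 → ℝ) → ℝ) (g : Fin 3 → ℕ → ℝ) (n : Fin 3 → ℕ) (drop : (Fin 3 → ℕ) → Prop) : CellCert where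
  cells := ((Fintype.piFinset fun k => Finset.range (n k)).filter fun j => ¬ drop j).image enc
  cell i := box (gridLo g (decd i)) (gridHi g (decd i))
  wt i := row (gridLo g (decd i)) (gridHi g (decd i))
  cliques := (((Fintype.piFinset fun k => Finset.range (n k)).filter fun j => ¬ drop j).image enc).image
    fun i => ({i} : Finset ℕ)
  y K := ∑ i ∈ K, max (row (gridLo g (decd i)) (gridHi g (decd i))) 0

/-- **THE GRID CERTIFICATE IS BOX-VALID (PROVED)** for a serving row, `0 ≤ R`, a grid `g k 0 ≤ −R`, `R ≤ g k (n k)` (no monotonicity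
needed), mesh row `< 49/100` on every grid box, and a drop-list every member of which fires an exclusion row. -/
theorem gridCert_boxValid {c a₁ a₂ R : ℝ} (hR : 0 ≤ R) {row : (Fin 3 → ℝ) → (Fin 3 → ℝ) → ℝ} (hrow : RowServes c a₁ a₂ row)
    {g : Fin 3 → ℕ → ℝ} {n : Fin 3 → ℕ} (hn : ∀ k, 0 < n k) (hlo : ∀ k, g k 0 ≤ -R) (hhi : ∀ k, R ≤ g k (n k))
    (hmesh : ∀ j : Fin 3 → ℕ, (∀ k, j k < n k) →
      (gridHi g j 0 - gridLo g j 0) ^ 2 + (gridHi g j 1 - gridLo g j 1) ^ 2 + (gridHi g j 2 - gridLo g j 2) ^ 2 < 49 / 100)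
    {drop : (Fin 3 → ℕ) → Prop} (hdrop : ∀ j : Fin 3 → ℕ, (∀ k, j k < n k) → drop j → Excluded R a₁ a₂ (gridLo g j) (gridHi g j)) :
    (gridCert row g n drop).BoxValid c a₁ a₂ R := by
  have hjk : ∀ {j : Fin 3 → ℕ}, j ∈ ((Fintype.piFinset fun k => Finset.range (n k)).filter fun j => ¬ drop j) →
      (∀ k, j k < n k) ∧ ¬ drop j := fun hj => by
    obtain ⟨hj1, hj2⟩ := Finset.mem_filter.1 hj
    exact ⟨fun k => Finset.mem_range.1 (Fintype.mem_piFinset.1 hj1 k), hj2⟩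
  refine ⟨?_, ?_, ?_, ?_, ?_⟩
  · intro z h7 hzR hor -- C1: grid cover + exclusion of the dropped boxes
    have hzI : (fun k => z k) ∈ Set.Icc (fun _ : Fin 3 => -R) (fun _ : Fin 3 => R) := by
      refine ⟨fun k => ?_, fun k => ?_⟩
      · have := abs_apply_le_norm z k
        linarith [neg_abs_le (z k)]
      · exact ((le_abs_self (z k)).trans (abs_apply_le_norm z k)).trans hzR
    obtain ⟨j, hj, hmem⟩ :=
      Literature.Computation.Certificates.BoxCovering.exists_gridCell_of_mem_Icc g n hn
        (lo := fun _ : Fin 3 => -R) (hi := fun _ : Fin 3 => R) hlo hhi hzI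
    have hzbox : z ∈ box (gridLo g j) (gridHi g j) := fun k => ⟨hmem.1 k, hmem.2 k⟩
    by_cases hd : drop j
    · exact (false_of_excluded hzbox hR (hdrop j hj hd) h7 hzR hor).elim
    · refine ⟨enc j, Finset.mem_image.2 ⟨j, Finset.mem_filter.2
        ⟨Fintype.mem_piFinset.2 fun k => Finset.mem_range.2 (hj k), hd⟩, rfl⟩, ?_⟩
      show z ∈ box (gridLo g (decd (enc j))) (gridHi g (decd (enc j)))
      rw [decd_enc]; exact hzbox
  · intro i _ z hzi h7 _ _ -- C2: the row serves the a-box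
    exact hrow _ _ z hzi h7
  · intro K hK i hi i' hi' z hz z' hz' -- C3: singleton cliques, mesh row
    obtain ⟨i₀, hi₀, rfl⟩ := Finset.mem_image.1 hK
    rw [Finset.mem_singleton] at hi hi'
    subst hi; subst hi'
    obtain ⟨j, hj, rfl⟩ := Finset.mem_image.1 hi₀
    change z ∈ box (gridLo g (decd (enc j))) (gridHi g (decd (enc j))) at hz
    change z' ∈ box (gridLo g (decd (enc j))) (gridHi g (decd (enc j))) at hz'
    rw [decd_enc] at hz hz'
    exact dist_lt_of_same_box hz hz' (hmesh j (hjk hj).1)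
  · intro i hi -- C4: the singleton {i} carries (wt i)₊
    have hmem : ({i} : Finset ℕ) ∈ (gridCert row g n drop).cliques.filter (fun K => i ∈ K) :=
      Finset.mem_filter.2 ⟨Finset.mem_image.2 ⟨i, hi, rfl⟩, Finset.mem_singleton_self i⟩
    have hy0 : ∀ K ∈ (gridCert row g n drop).cliques.filter (fun K => i ∈ K), 0 ≤ (gridCert row g n drop).y K :=
      fun K _ => Finset.sum_nonneg fun _ _ => le_max_right _ _
    calc (gridCert row g n drop).wt i ≤ (gridCert row g n drop).y {i} := by
          show row (gridLo g (decd i)) (gridHi g (decd i)) ≤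
            ∑ i' ∈ ({i} : Finset ℕ), max (row (gridLo g (decd i')) (gridHi g (decd i'))) 0
          rw [Finset.sum_singleton]; exact le_max_left _ _
      _ ≤ _ := Finset.single_le_sum hy0 hmem
  · exact fun K _ => Finset.sum_nonneg fun _ _ => le_max_right _ _ -- C5

end Summit.AtomisticToContinuum.Crystallization.Theorems.LoopTunnelDialForcePricing

end
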